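import Literature.MathematicalPhysics.QuantumLattice.HubbardShiftedSliceGram
import Literature.MathematicalPhysics.QuantumLattice.HubbardShiftedSliceSymbolDifferences
import HarnessLib

/-!
# The shifted slice symbol as a smooth function of the frequency: derivatives up to order two, `|∂_ω² p| ≲ βL²/Λ³`

Topic `MathematicalPhysics/QuantumLattice`; the continuum side of the second-difference bounds of the slice symbols (cell gate-hubbard-kl,
R0-SCOPE-4 W2c).  The symbol of the shifted Salmhofer slice `C^θ_{(Λ,Λ′]}` (`HubbardShiftedSliceCovariance`),
`p(k) = (w_Λ(k) - w_{Λ′}(k)) · βL²/(-i(ω+θ)+ξ)`, `w_Λ(k) = χ₂((ω²+ξ²)/Λ²)`, is the restriction to the Matsubara frequencies of the smooth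
function `Ψ_ξ(ω) = W(ω) R(ω)`, `W(ω) = χ₂((ω²+ξ²)/Λ²) - χ₂((ω²+ξ²)/Λ′²)`, `R(ω) = c/(-i(ω+θ)+ξ)` (`c = βL²`).  Here: `W` and its first two
derivatives are bounded by `1`, `4B₁/Λ`, `(8B₂+4B₁)/Λ²` (`B₁, B₂` global bounds of `χ₂′, χ₂″`, `exists_deriv_bounds_salmhoferCutoff`) and vanish
off the closed shell `Λ²/4 ≤ ω²+ξ² ≤ Λ′²`; on that shell `|-i(ω+θ)+ξ| ≥ Λ/4` as soon as `|θ| ≤ Λ/4`, so `R, R′, R″` are at most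
`4c/Λ, 16c/Λ², 128c/Λ³`; hence `Ψ_ξ` is twice differentiable on `ℝ` with **`‖Ψ_ξ″‖ ≤ (32B₂ + 144B₁ + 128)·c/Λ³`** everywhere
(Benfatto–Giuliani–Mastropietro 2006, (2.36aa)/(2.50): derivatives of a single-scale symbol cost inverse powers of the scale).

* `exists_deriv_bounds_salmhoferCutoff`, `deriv_salmhoferCutoff_eq_zero_of_lt`, `…_of_gt` (and for `χ₂″`);
* `sliceWeightFn`, `sliceWeightFnD1`, `sliceWeightFnD2` with `hasDerivAt_…`, the bounds and the vanishing off the shell;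
* `resolventFn`, `resolventFnD1`, `resolventFnD2` with `hasDerivAt_…` and the norms; `norm_shiftDen_ge` (`|a| ≥ Λ/4` on the shell);
* `sliceSymbolFn`, `sliceSymbolFnD1`, `sliceSymbolFnD2`: **`hasDerivAt_sliceSymbolFn`**, **`hasDerivAt_sliceSymbolFnD1`**,
  **`norm_sliceSymbolFnD2_le`**; `sliceSymbol_eq_sliceSymbolFn` — the lattice symbol is the restriction.

Everything is proved; the nine functions are the only definitions; no named facts.

## Sources

G. Benfatto, A. Giuliani, V. Mastropietro, Ann. Henri Poincaré 7 (2006) 809–898, (2.36aa), (2.50) (`BenfattoGiulianiMastropietro2006`);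
M. Salmhofer, *Renormalization* (1999), §4.2.5 (4.70)–(4.71) (`Salmhofer1999`).
-/

noncomputable section

namespace Literature.MathematicalPhysics.QuantumLattice

open Literature.Probability.LatticeModels Set Complex

/-! ### Global bounds for `χ₂′` and `χ₂″` -/

/-- `χ₂` is differentiable with derivative `deriv χ₂`. [cite: Salmhofer1999, §4.2.5 (4.71)] -/
theorem hasDerivAt_salmhoferCutoff (x : ℝ) : HasDerivAt salmhoferCutoff (deriv salmhoferCutoff x) x :=
  ((contDiff_salmhoferCutoff (n := 2)).differentiable (by norm_num) x).hasDerivAt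

/-- `χ₂′` is differentiable with derivative `deriv (deriv χ₂)`. [cite: Salmhofer1999, §4.2.5 (4.71)] -/
theorem hasDerivAt_deriv_salmhoferCutoff (x : ℝ) :
    HasDerivAt (deriv salmhoferCutoff) (deriv (deriv salmhoferCutoff) x) x := by
  have h2 : ContDiff ℝ 2 salmhoferCutoff := contDiff_salmhoferCutoff
  have h1 : ContDiff ℝ 1 (deriv salmhoferCutoff) := by
    rw [show (2 : WithTop ℕ∞) = 1 + 1 by norm_num] at h2
    exact (contDiff_succ_iff_deriv.1 h2).2.2
  exact (h1.differentiable one_ne_zero x).hasDerivAt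

/-- Off `[¼, 1]` the cutoff is locally constant, so `χ₂′ = 0` below `¼`. [cite: Salmhofer1999, §4.2.5 (4.71)] -/
theorem deriv_salmhoferCutoff_eq_zero_of_lt {x : ℝ} (hx : x < 1 / 4) : deriv salmhoferCutoff x = 0 := by
  have hev : salmhoferCutoff =ᶠ[nhds x] fun _ => (0 : ℝ) := by
    filter_upwards [Iio_mem_nhds hx] with y hy
    exact salmhoferCutoff_of_le (le_of_lt hy)
  rw [hev.deriv_eq, deriv_const]

/-- `χ₂′ = 0` above `1`. [cite: Salmhofer1999, §4.2.5 (4.71)] -/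
theorem deriv_salmhoferCutoff_eq_zero_of_gt {x : ℝ} (hx : 1 < x) : deriv salmhoferCutoff x = 0 := by
  have hev : salmhoferCutoff =ᶠ[nhds x] fun _ => (1 : ℝ) := by
    filter_upwards [Ioi_mem_nhds hx] with y hy
    exact salmhoferCutoff_of_ge (le_of_lt hy)
  rw [hev.deriv_eq, deriv_const]

/-- `χ₂″ = 0` below `¼`. [cite: Salmhofer1999, §4.2.5 (4.71)] -/
theorem deriv_deriv_salmhoferCutoff_eq_zero_of_lt {x : ℝ} (hx : x < 1 / 4) : deriv (deriv salmhoferCutoff) x = 0 := by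
  have hev : deriv salmhoferCutoff =ᶠ[nhds x] fun _ => (0 : ℝ) := by
    filter_upwards [Iio_mem_nhds hx] with y hy
    exact deriv_salmhoferCutoff_eq_zero_of_lt hy
  rw [hev.deriv_eq, deriv_const]

/-- `χ₂″ = 0` above `1`. [cite: Salmhofer1999, §4.2.5 (4.71)] -/
theorem deriv_deriv_salmhoferCutoff_eq_zero_of_gt {x : ℝ} (hx : 1 < x) : deriv (deriv salmhoferCutoff) x = 0 := by
  have hev : deriv salmhoferCutoff =ᶠ[nhds x] fun _ => (0 : ℝ) := by
    filter_upwards [Ioi_mem_nhds hx] with y hy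
    exact deriv_salmhoferCutoff_eq_zero_of_gt hy
  rw [hev.deriv_eq, deriv_const]

/-- **Global bounds for the first two derivatives of Salmhofer's cutoff**: `∃ B₁ B₂ ≥ 0, |χ₂′| ≤ B₁, |χ₂″| ≤ B₂` (continuous and
vanishing off `[0, 2]`). [cite: Salmhofer1999, §4.2.5 (4.71)] -/
theorem exists_deriv_bounds_salmhoferCutoff :
    ∃ B₁ B₂ : ℝ, 0 ≤ B₁ ∧ 0 ≤ B₂ ∧ (∀ x, |deriv salmhoferCutoff x| ≤ B₁) ∧ ∀ x, |deriv (deriv salmhoferCutoff) x| ≤ B₂ := by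
  have h2 : ContDiff ℝ 2 salmhoferCutoff := contDiff_salmhoferCutoff
  have hc1 : Continuous (deriv salmhoferCutoff) := h2.continuous_deriv (by norm_num)
  have hc2 : Continuous (deriv (deriv salmhoferCutoff)) := by
    have h1 : ContDiff ℝ 1 (deriv salmhoferCutoff) := by
      rw [show (2 : WithTop ℕ∞) = 1 + 1 by norm_num] at h2
      exact (contDiff_succ_iff_deriv.1 h2).2.2
    exact h1.continuous_deriv le_rfl
  obtain ⟨C₁, hC₁⟩ := (isCompact_Icc : IsCompact (Icc (0 : ℝ) 2)).exists_bound_of_continuousOn hc1.continuousOn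
  obtain ⟨C₂, hC₂⟩ := (isCompact_Icc : IsCompact (Icc (0 : ℝ) 2)).exists_bound_of_continuousOn hc2.continuousOn
  have hout : ∀ x : ℝ, x ∉ Icc (0 : ℝ) 2 → deriv salmhoferCutoff x = 0 ∧ deriv (deriv salmhoferCutoff) x = 0 := by
    intro x hx
    rw [Set.mem_Icc, not_and_or, not_le, not_le] at hx
    rcases hx with hx | hx
    · exact ⟨deriv_salmhoferCutoff_eq_zero_of_lt (by linarith), deriv_deriv_salmhoferCutoff_eq_zero_of_lt (by linarith)⟩
    · exact ⟨deriv_salmhoferCutoff_eq_zero_of_gt (by linarith), deriv_deriv_salmhoferCutoff_eq_zero_of_gt (by linarith)⟩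
  refine ⟨max C₁ 0, max C₂ 0, le_max_right _ _, le_max_right _ _, fun x => ?_, fun x => ?_⟩
  · by_cases hx : x ∈ Icc (0 : ℝ) 2
    · exact (Real.norm_eq_abs _ ▸ hC₁ x hx).trans (le_max_left _ _)
    · rw [(hout x hx).1, abs_zero]; exact le_max_right _ _
  · by_cases hx : x ∈ Icc (0 : ℝ) 2
    · exact (Real.norm_eq_abs _ ▸ hC₂ x hx).trans (le_max_left _ _)
    · rw [(hout x hx).2, abs_zero]; exact le_max_right _ _

/-! ### The slice weight as a function of the frequency -/

/-- The **continuum slice weight** `W(ω) = χ₂((ω²+ξ²)/Λ²) - χ₂((ω²+ξ²)/Λ′²)` (Salmhofer (4.70)–(4.71)).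
[cite: Salmhofer1999, §4.2.5 (4.70)] -/
def sliceWeightFn (Λ Λ' ξ ω : ℝ) : ℝ :=
  salmhoferCutoff ((ω ^ 2 + ξ ^ 2) / Λ ^ 2) - salmhoferCutoff ((ω ^ 2 + ξ ^ 2) / Λ' ^ 2)

/-- Its first `ω`-derivative `χ₂′(h/Λ²)·2ω/Λ² - χ₂′(h/Λ′²)·2ω/Λ′²`. [cite: Salmhofer1999, §4.2.5 (4.70)] -/
def sliceWeightFnD1 (Λ Λ' ξ ω : ℝ) : ℝ :=
  deriv salmhoferCutoff ((ω ^ 2 + ξ ^ 2) / Λ ^ 2) * (2 * ω / Λ ^ 2) -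
    deriv salmhoferCutoff ((ω ^ 2 + ξ ^ 2) / Λ' ^ 2) * (2 * ω / Λ' ^ 2)

/-- Its second `ω`-derivative. [cite: Salmhofer1999, §4.2.5 (4.70)] -/
def sliceWeightFnD2 (Λ Λ' ξ ω : ℝ) : ℝ :=
  (deriv (deriv salmhoferCutoff) ((ω ^ 2 + ξ ^ 2) / Λ ^ 2) * (2 * ω / Λ ^ 2) * (2 * ω / Λ ^ 2) +
      deriv salmhoferCutoff ((ω ^ 2 + ξ ^ 2) / Λ ^ 2) * (2 / Λ ^ 2)) -
    (deriv (deriv salmhoferCutoff) ((ω ^ 2 + ξ ^ 2) / Λ' ^ 2) * (2 * ω / Λ' ^ 2) * (2 * ω / Λ' ^ 2) +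
      deriv salmhoferCutoff ((ω ^ 2 + ξ ^ 2) / Λ' ^ 2) * (2 / Λ' ^ 2))

/-- The argument `h(ω)/Λ² = (ω²+ξ²)/Λ²` has derivative `2ω/Λ²`. [cite: Salmhofer1999, §4.2.5 (4.70)] -/
theorem hasDerivAt_sqArg (Λ ξ ω : ℝ) : HasDerivAt (fun t : ℝ => (t ^ 2 + ξ ^ 2) / Λ ^ 2) (2 * ω / Λ ^ 2) ω := by
  have h := ((hasDerivAt_pow 2 ω).add_const (ξ ^ 2)).div_const (Λ ^ 2)
  simpa [pow_one, mul_comm] using h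

/-- `W′ = sliceWeightFnD1`. [cite: Salmhofer1999, §4.2.5 (4.70)] -/
theorem hasDerivAt_sliceWeightFn (Λ Λ' ξ ω : ℝ) :
    HasDerivAt (sliceWeightFn Λ Λ' ξ) (sliceWeightFnD1 Λ Λ' ξ ω) ω := by
  unfold sliceWeightFn sliceWeightFnD1
  exact ((hasDerivAt_salmhoferCutoff _).comp ω (hasDerivAt_sqArg Λ ξ ω)).sub
    ((hasDerivAt_salmhoferCutoff _).comp ω (hasDerivAt_sqArg Λ' ξ ω))

/-- `W″ = sliceWeightFnD2`. [cite: Salmhofer1999, §4.2.5 (4.70)] -/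
theorem hasDerivAt_sliceWeightFnD1 (Λ Λ' ξ ω : ℝ) :
    HasDerivAt (sliceWeightFnD1 Λ Λ' ξ) (sliceWeightFnD2 Λ Λ' ξ ω) ω := by
  unfold sliceWeightFnD1 sliceWeightFnD2
  have hlin : ∀ c : ℝ, HasDerivAt (fun t : ℝ => 2 * t / c) (2 / c) ω := fun c => by
    simpa using ((hasDerivAt_id ω).const_mul 2).div_const c
  exact (((hasDerivAt_deriv_salmhoferCutoff _).comp ω (hasDerivAt_sqArg Λ ξ ω)).mul (hlin (Λ ^ 2))).sub
    (((hasDerivAt_deriv_salmhoferCutoff _).comp ω (hasDerivAt_sqArg Λ' ξ ω)).mul (hlin (Λ' ^ 2)))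

/-- `|W| ≤ 1`. [cite: Salmhofer1999, §4.2.5 (4.71)] -/
theorem abs_sliceWeightFn_le_one (Λ Λ' ξ ω : ℝ) : |sliceWeightFn Λ Λ' ξ ω| ≤ 1 := by
  unfold sliceWeightFn
  have h1 := salmhoferCutoff_mem_Icc ((ω ^ 2 + ξ ^ 2) / Λ ^ 2)
  have h2 := salmhoferCutoff_mem_Icc ((ω ^ 2 + ξ ^ 2) / Λ' ^ 2)
  exact abs_le.2 ⟨by linarith [h1.1, h1.2, h2.1, h2.2], by linarith [h1.1, h1.2, h2.1, h2.2]⟩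

section WeightBounds

variable {B₁ B₂ : ℝ} (hB₁ : ∀ x, |deriv salmhoferCutoff x| ≤ B₁) (hB₂ : ∀ x, |deriv (deriv salmhoferCutoff) x| ≤ B₂)

/-- One chain-rule term: `|χ₂′((ω²+ξ²)/Λ²)·2ω/Λ²| ≤ 2B₁/Λ` (the factor vanishes unless `ω² ≤ ω²+ξ² ≤ Λ²`).
[cite: BenfattoGiulianiMastropietro2006, (2.36aa)] -/
theorem abs_deriv_term_le (hB₁ : ∀ x, |deriv salmhoferCutoff x| ≤ B₁) {Λ : ℝ} (hΛ : 0 < Λ) (ξ ω : ℝ) :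
    |deriv salmhoferCutoff ((ω ^ 2 + ξ ^ 2) / Λ ^ 2) * (2 * ω / Λ ^ 2)| ≤ 2 * B₁ / Λ := by
  have hB0 : 0 ≤ B₁ := (abs_nonneg _).trans (hB₁ 0)
  by_cases hgt : 1 < (ω ^ 2 + ξ ^ 2) / Λ ^ 2
  · rw [deriv_salmhoferCutoff_eq_zero_of_gt hgt, zero_mul, abs_zero]; positivity
  · have hω : |ω| ≤ Λ := by
      rw [not_lt, div_le_one (by positivity)] at hgt
      exact abs_le_of_sq_le_sq' (by nlinarith [sq_nonneg ξ]) hΛ.le |>.elim (fun h1 h2 => abs_le.2 ⟨h1, h2⟩)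
    rw [abs_mul]
    calc |deriv salmhoferCutoff ((ω ^ 2 + ξ ^ 2) / Λ ^ 2)| * |2 * ω / Λ ^ 2| ≤ B₁ * (2 * Λ / Λ ^ 2) := by
          refine mul_le_mul (hB₁ _) ?_ (abs_nonneg _) hB0
          rw [abs_div, abs_mul, abs_of_pos (by norm_num : (0:ℝ) < 2), abs_of_pos (by positivity : (0:ℝ) < Λ ^ 2)]
          exact div_le_div_of_nonneg_right (by linarith) (by positivity)
      _ = 2 * B₁ / Λ := by field_simp

/-- The second-order chain-rule terms: `|χ₂″(h/Λ²)(2ω/Λ²)² + χ₂′(h/Λ²)·2/Λ²| ≤ (4B₂ + 2B₁)/Λ²`.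
[cite: BenfattoGiulianiMastropietro2006, (2.36aa)] -/
theorem abs_deriv2_term_le (hB₁ : ∀ x, |deriv salmhoferCutoff x| ≤ B₁) (hB₂ : ∀ x, |deriv (deriv salmhoferCutoff) x| ≤ B₂)
    {Λ : ℝ} (hΛ : 0 < Λ) (ξ ω : ℝ) :
    |deriv (deriv salmhoferCutoff) ((ω ^ 2 + ξ ^ 2) / Λ ^ 2) * (2 * ω / Λ ^ 2) * (2 * ω / Λ ^ 2) +
        deriv salmhoferCutoff ((ω ^ 2 + ξ ^ 2) / Λ ^ 2) * (2 / Λ ^ 2)| ≤ (4 * B₂ + 2 * B₁) / Λ ^ 2 := by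
  have hB10 : 0 ≤ B₁ := (abs_nonneg _).trans (hB₁ 0)
  have hB20 : 0 ≤ B₂ := (abs_nonneg _).trans (hB₂ 0)
  have hsecond : |deriv salmhoferCutoff ((ω ^ 2 + ξ ^ 2) / Λ ^ 2) * (2 / Λ ^ 2)| ≤ 2 * B₁ / Λ ^ 2 := by
    rw [abs_mul, abs_of_pos (by positivity : (0:ℝ) < 2 / Λ ^ 2)]
    calc |deriv salmhoferCutoff ((ω ^ 2 + ξ ^ 2) / Λ ^ 2)| * (2 / Λ ^ 2) ≤ B₁ * (2 / Λ ^ 2) :=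
          mul_le_mul_of_nonneg_right (hB₁ _) (by positivity)
      _ = 2 * B₁ / Λ ^ 2 := by ring
  have hfirst : |deriv (deriv salmhoferCutoff) ((ω ^ 2 + ξ ^ 2) / Λ ^ 2) * (2 * ω / Λ ^ 2) * (2 * ω / Λ ^ 2)| ≤
      4 * B₂ / Λ ^ 2 := by
    by_cases hgt : 1 < (ω ^ 2 + ξ ^ 2) / Λ ^ 2
    · rw [deriv_deriv_salmhoferCutoff_eq_zero_of_gt hgt, zero_mul, zero_mul, abs_zero]; positivity
    · have hω2 : ω ^ 2 ≤ Λ ^ 2 := by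
        rw [not_lt, div_le_one (by positivity)] at hgt
        nlinarith [sq_nonneg ξ]
      rw [mul_assoc, abs_mul]
      have hsq : |2 * ω / Λ ^ 2 * (2 * ω / Λ ^ 2)| ≤ 4 / Λ ^ 2 := by
        rw [show 2 * ω / Λ ^ 2 * (2 * ω / Λ ^ 2) = 4 * ω ^ 2 / (Λ ^ 2 * Λ ^ 2) by field_simp; ring,
          abs_of_nonneg (by positivity), div_le_div_iff₀ (by positivity) (by positivity)]
        nlinarith [pow_pos hΛ 2]
      calc |deriv (deriv salmhoferCutoff) ((ω ^ 2 + ξ ^ 2) / Λ ^ 2)| * |2 * ω / Λ ^ 2 * (2 * ω / Λ ^ 2)| ≤ B₂ * (4 / Λ ^ 2) :=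
            mul_le_mul (hB₂ _) hsq (abs_nonneg _) hB20
        _ = 4 * B₂ / Λ ^ 2 := by ring
  calc _ ≤ |deriv (deriv salmhoferCutoff) ((ω ^ 2 + ξ ^ 2) / Λ ^ 2) * (2 * ω / Λ ^ 2) * (2 * ω / Λ ^ 2)| +
        |deriv salmhoferCutoff ((ω ^ 2 + ξ ^ 2) / Λ ^ 2) * (2 / Λ ^ 2)| := abs_add_le _ _
    _ ≤ 4 * B₂ / Λ ^ 2 + 2 * B₁ / Λ ^ 2 := add_le_add hfirst hsecond
    _ = (4 * B₂ + 2 * B₁) / Λ ^ 2 := by ring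

/-- **`|W′| ≤ 4B₁/Λ`** (`0 < Λ ≤ Λ′`). [cite: BenfattoGiulianiMastropietro2006, (2.36aa)] -/
theorem abs_sliceWeightFnD1_le (hB₁ : ∀ x, |deriv salmhoferCutoff x| ≤ B₁) {Λ Λ' : ℝ} (hΛ : 0 < Λ) (hΛΛ' : Λ ≤ Λ')
    (ξ ω : ℝ) : |sliceWeightFnD1 Λ Λ' ξ ω| ≤ 4 * B₁ / Λ := by
  have hB0 : 0 ≤ B₁ := (abs_nonneg _).trans (hB₁ 0)
  have hΛ' : 0 < Λ' := hΛ.trans_le hΛΛ'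
  unfold sliceWeightFnD1
  have h1 := abs_deriv_term_le hB₁ hΛ ξ ω
  have h2 := abs_deriv_term_le hB₁ hΛ' ξ ω
  have h3 : 2 * B₁ / Λ' ≤ 2 * B₁ / Λ := div_le_div_of_nonneg_left (by positivity) hΛ hΛΛ'
  calc _ ≤ |deriv salmhoferCutoff ((ω ^ 2 + ξ ^ 2) / Λ ^ 2) * (2 * ω / Λ ^ 2)| +
        |deriv salmhoferCutoff ((ω ^ 2 + ξ ^ 2) / Λ' ^ 2) * (2 * ω / Λ' ^ 2)| := abs_sub _ _
    _ ≤ 2 * B₁ / Λ + 2 * B₁ / Λ := add_le_add h1 (h2.trans h3)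
    _ = 4 * B₁ / Λ := by ring

/-- **`|W″| ≤ (8B₂ + 4B₁)/Λ²`** (`0 < Λ ≤ Λ′`). [cite: BenfattoGiulianiMastropietro2006, (2.36aa)] -/
theorem abs_sliceWeightFnD2_le (hB₁ : ∀ x, |deriv salmhoferCutoff x| ≤ B₁) (hB₂ : ∀ x, |deriv (deriv salmhoferCutoff) x| ≤ B₂)
    {Λ Λ' : ℝ} (hΛ : 0 < Λ) (hΛΛ' : Λ ≤ Λ') (ξ ω : ℝ) : |sliceWeightFnD2 Λ Λ' ξ ω| ≤ (8 * B₂ + 4 * B₁) / Λ ^ 2 := by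
  have hB10 : 0 ≤ B₁ := (abs_nonneg _).trans (hB₁ 0)
  have hB20 : 0 ≤ B₂ := (abs_nonneg _).trans (hB₂ 0)
  have hΛ' : 0 < Λ' := hΛ.trans_le hΛΛ'
  unfold sliceWeightFnD2
  refine (abs_sub _ _).trans ?_
  have h1 := abs_deriv2_term_le hB₁ hB₂ hΛ ξ ω
  have h2 := abs_deriv2_term_le hB₁ hB₂ hΛ' ξ ω
  have h3 : (4 * B₂ + 2 * B₁) / Λ' ^ 2 ≤ (4 * B₂ + 2 * B₁) / Λ ^ 2 :=
    div_le_div_of_nonneg_left (by positivity) (by positivity) (pow_le_pow_left₀ hΛ.le hΛΛ' 2)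
  calc _ ≤ (4 * B₂ + 2 * B₁) / Λ ^ 2 + (4 * B₂ + 2 * B₁) / Λ' ^ 2 := add_le_add h1 h2
    _ ≤ (4 * B₂ + 2 * B₁) / Λ ^ 2 + (4 * B₂ + 2 * B₁) / Λ ^ 2 := by linarith
    _ = (8 * B₂ + 4 * B₁) / Λ ^ 2 := by ring

end WeightBounds

/-- **Off the closed shell `Λ²/4 ≤ ω²+ξ² ≤ Λ′²` the weight and its two derivatives vanish** (`0 < Λ ≤ Λ′`).
[cite: Salmhofer1999, §4.2.5 (4.71)] -/
theorem sliceWeightFn_eq_zero_of_not_mem {Λ Λ' : ℝ} (hΛ : 0 < Λ) (hΛΛ' : Λ ≤ Λ') {ξ ω : ℝ}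
    (h : ω ^ 2 + ξ ^ 2 < Λ ^ 2 / 4 ∨ Λ' ^ 2 < ω ^ 2 + ξ ^ 2) :
    sliceWeightFn Λ Λ' ξ ω = 0 ∧ sliceWeightFnD1 Λ Λ' ξ ω = 0 ∧ sliceWeightFnD2 Λ Λ' ξ ω = 0 := by
  have hΛ' : 0 < Λ' := hΛ.trans_le hΛΛ'
  have hΛ2 : Λ ^ 2 ≤ Λ' ^ 2 := pow_le_pow_left₀ hΛ.le hΛΛ' 2
  unfold sliceWeightFn sliceWeightFnD1 sliceWeightFnD2
  rcases h with h | h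
  · -- below both transition regions
    have h1 : (ω ^ 2 + ξ ^ 2) / Λ ^ 2 < 1 / 4 := by rw [div_lt_iff₀ (by positivity)]; linarith
    have h2 : (ω ^ 2 + ξ ^ 2) / Λ' ^ 2 < 1 / 4 := by
      rw [div_lt_iff₀ (by positivity)]; nlinarith [sq_nonneg ω, sq_nonneg ξ]
    simp [salmhoferCutoff_of_le h1.le, salmhoferCutoff_of_le h2.le, deriv_salmhoferCutoff_eq_zero_of_lt h1,
      deriv_salmhoferCutoff_eq_zero_of_lt h2, deriv_deriv_salmhoferCutoff_eq_zero_of_lt h1,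
      deriv_deriv_salmhoferCutoff_eq_zero_of_lt h2]
  · -- above both transition regions
    have h1 : 1 < (ω ^ 2 + ξ ^ 2) / Λ ^ 2 := by rw [lt_div_iff₀ (by positivity)]; linarith
    have h2 : 1 < (ω ^ 2 + ξ ^ 2) / Λ' ^ 2 := by rw [lt_div_iff₀ (by positivity)]; linarith
    simp [salmhoferCutoff_of_ge h1.le, salmhoferCutoff_of_ge h2.le, deriv_salmhoferCutoff_eq_zero_of_gt h1,
      deriv_salmhoferCutoff_eq_zero_of_gt h2, deriv_deriv_salmhoferCutoff_eq_zero_of_gt h1,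
      deriv_deriv_salmhoferCutoff_eq_zero_of_gt h2]

/-! ### The resolvent factor `c/(-i(ω+θ)+ξ)` -/

/-- The **resolvent factor** `R(ω) = c/(-i(ω+θ)+ξ)` of the shifted symbol (`c = βL²`; BGM (2.3) at complex chemical potential).
[cite: BenfattoGiulianiMastropietro2006, §2.1 (2.3)] -/
def resolventFn (c θ ξ ω : ℝ) : ℂ := (c : ℂ) / (-I * ((ω + θ : ℝ) : ℂ) + (ξ : ℂ))

/-- `R′ = c·i/(-i(ω+θ)+ξ)²`. [cite: BenfattoGiulianiMastropietro2006, §2.1 (2.3)] -/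
def resolventFnD1 (c θ ξ ω : ℝ) : ℂ := (c : ℂ) * I / (-I * ((ω + θ : ℝ) : ℂ) + (ξ : ℂ)) ^ 2

/-- `R″ = -2c/(-i(ω+θ)+ξ)³`. [cite: BenfattoGiulianiMastropietro2006, §2.1 (2.3)] -/
def resolventFnD2 (c θ ξ ω : ℝ) : ℂ := -2 * (c : ℂ) / (-I * ((ω + θ : ℝ) : ℂ) + (ξ : ℂ)) ^ 3

/-- The denominator has derivative `-i`. [cite: BenfattoGiulianiMastropietro2006, §2.1 (2.3)] -/
theorem hasDerivAt_shiftDen (θ ξ ω : ℝ) : HasDerivAt (fun t : ℝ => -I * ((t + θ : ℝ) : ℂ) + (ξ : ℂ)) (-I * 1) ω := by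
  have h1 : HasDerivAt (fun t : ℝ => ((t + θ : ℝ) : ℂ)) 1 ω := by
    have := ((hasDerivAt_id ω).add_const θ).ofReal_comp
    simpa using this
  simpa using (h1.const_mul (-I)).add_const (ξ : ℂ)

/-- `‖-i(ω+θ)+ξ‖² = (ω+θ)² + ξ²`. [cite: BenfattoGiulianiMastropietro2006, §2.1 (2.3)] -/
theorem norm_sq_shiftDen (θ ξ ω : ℝ) : ‖-I * ((ω + θ : ℝ) : ℂ) + (ξ : ℂ)‖ ^ 2 = (ω + θ) ^ 2 + ξ ^ 2 := by
  rw [Complex.sq_norm, Complex.normSq_apply]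
  simp
  ring

/-- **On the shell the denominator is at least `Λ/4`**: `Λ²/4 ≤ ω²+ξ²` and `|θ| ≤ Λ/4` give `Λ²/16 ≤ (ω+θ)²+ξ²`.
[cite: BenfattoGiulianiMastropietro2006, §2.1 (2.3)] -/
theorem sq_shiftDen_ge {Λ θ ξ ω : ℝ} (hθ : |θ| ≤ Λ / 4) (h : Λ ^ 2 / 4 ≤ ω ^ 2 + ξ ^ 2) :
    Λ ^ 2 / 16 ≤ (ω + θ) ^ 2 + ξ ^ 2 := by
  have hθ2 : θ ^ 2 ≤ Λ ^ 2 / 16 := by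
    have := sq_abs θ ▸ pow_le_pow_left₀ (abs_nonneg θ) hθ 2
    nlinarith
  nlinarith [sq_nonneg (ω + 2 * θ)]

/-- `‖-i(ω+θ)+ξ‖ ≥ Λ/4` on the shell. [cite: BenfattoGiulianiMastropietro2006, §2.1 (2.3)] -/
theorem norm_shiftDen_ge {Λ θ ξ ω : ℝ} (hθ : |θ| ≤ Λ / 4) (h : Λ ^ 2 / 4 ≤ ω ^ 2 + ξ ^ 2) :
    Λ / 4 ≤ ‖-I * ((ω + θ : ℝ) : ℂ) + (ξ : ℂ)‖ := by
  have h1 : (Λ / 4) ^ 2 ≤ ‖-I * ((ω + θ : ℝ) : ℂ) + (ξ : ℂ)‖ ^ 2 := by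
    rw [norm_sq_shiftDen]; linarith [sq_shiftDen_ge hθ h]
  exact (abs_le_of_sq_le_sq' h1 (norm_nonneg _)).2

/-- `R′`: for a nonzero denominator, `R` has derivative `resolventFnD1`. [cite: BenfattoGiulianiMastropietro2006, §2.1 (2.3)] -/
theorem hasDerivAt_resolventFn {c θ ξ ω : ℝ} (h : (-I * ((ω + θ : ℝ) : ℂ) + (ξ : ℂ)) ≠ 0) :
    HasDerivAt (resolventFn c θ ξ) (resolventFnD1 c θ ξ ω) ω := by
  unfold resolventFn resolventFnD1
  have hinv := ((hasDerivAt_inv h).comp ω (hasDerivAt_shiftDen θ ξ ω)).const_mul (c : ℂ)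
  refine (hinv.congr_of_eventuallyEq (Filter.Eventually.of_forall fun t => ?_)).congr_deriv ?_
  · simp only [Function.comp, div_eq_mul_inv]
  · field_simp

/-- `R″`: for a nonzero denominator, `R′` has derivative `resolventFnD2`. [cite: BenfattoGiulianiMastropietro2006, §2.1 (2.3)] -/
theorem hasDerivAt_resolventFnD1 {c θ ξ ω : ℝ} (h : (-I * ((ω + θ : ℝ) : ℂ) + (ξ : ℂ)) ≠ 0) :
    HasDerivAt (resolventFnD1 c θ ξ) (resolventFnD2 c θ ξ ω) ω := by
  unfold resolventFnD1 resolventFnD2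
  have h2 : (-I * ((ω + θ : ℝ) : ℂ) + (ξ : ℂ)) ^ 2 ≠ 0 := pow_ne_zero 2 h
  have hsq : HasDerivAt (fun t : ℝ => (-I * ((t + θ : ℝ) : ℂ) + (ξ : ℂ)) ^ 2)
      ((2 : ℕ) * (-I * ((ω + θ : ℝ) : ℂ) + (ξ : ℂ)) ^ (2 - 1) * (-I * 1)) ω :=
    (hasDerivAt_shiftDen θ ξ ω).pow 2
  have hinv := ((hasDerivAt_inv h2).comp ω hsq).const_mul ((c : ℂ) * I)
  refine (hinv.congr_of_eventuallyEq (Filter.Eventually.of_forall fun t => ?_)).congr_deriv ?_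
  · simp only [Function.comp, div_eq_mul_inv]
  · set a : ℂ := -I * ((ω + θ : ℝ) : ℂ) + (ξ : ℂ) with ha
    have h3 : a ^ 3 ≠ 0 := pow_ne_zero 3 h
    rw [show (2 : ℕ) - 1 = 1 from rfl, pow_one]
    field_simp
    ring_nf
    rw [Complex.I_sq]
    ring

/-- `‖R‖ = c/|a|`. [cite: BenfattoGiulianiMastropietro2006, §2.1 (2.3)] -/
theorem norm_resolventFn {c : ℝ} (hc : 0 ≤ c) (θ ξ ω : ℝ) :
    ‖resolventFn c θ ξ ω‖ = c / ‖-I * ((ω + θ : ℝ) : ℂ) + (ξ : ℂ)‖ := by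
  rw [resolventFn, norm_div, Complex.norm_real, Real.norm_eq_abs, abs_of_nonneg hc]

/-- `‖R′‖ = c/|a|²`. [cite: BenfattoGiulianiMastropietro2006, §2.1 (2.3)] -/
theorem norm_resolventFnD1 {c : ℝ} (hc : 0 ≤ c) (θ ξ ω : ℝ) :
    ‖resolventFnD1 c θ ξ ω‖ = c / ‖-I * ((ω + θ : ℝ) : ℂ) + (ξ : ℂ)‖ ^ 2 := by
  rw [resolventFnD1, norm_div, norm_mul, Complex.norm_real, Real.norm_eq_abs, abs_of_nonneg hc, Complex.norm_I, mul_one,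
    norm_pow]

/-- `‖R″‖ = 2c/|a|³`. [cite: BenfattoGiulianiMastropietro2006, §2.1 (2.3)] -/
theorem norm_resolventFnD2 {c : ℝ} (hc : 0 ≤ c) (θ ξ ω : ℝ) :
    ‖resolventFnD2 c θ ξ ω‖ = 2 * c / ‖-I * ((ω + θ : ℝ) : ℂ) + (ξ : ℂ)‖ ^ 3 := by
  rw [resolventFnD2, norm_div, norm_mul, norm_neg, Complex.norm_real, Real.norm_eq_abs, abs_of_nonneg hc, norm_pow]
  norm_num

/-! ### The slice symbol `Ψ = W · R` -/

/-- The **continuum slice symbol** `Ψ_ξ(ω) = W(ω) R(ω)`. [cite: Salmhofer1999, §4.2.5 (4.70)] -/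
def sliceSymbolFn (c θ Λ Λ' ξ ω : ℝ) : ℂ := (sliceWeightFn Λ Λ' ξ ω : ℂ) * resolventFn c θ ξ ω

/-- `Ψ′ = W′R + WR′` (as a formal expression). [cite: Salmhofer1999, §4.2.5 (4.70)] -/
def sliceSymbolFnD1 (c θ Λ Λ' ξ ω : ℝ) : ℂ :=
  (sliceWeightFnD1 Λ Λ' ξ ω : ℂ) * resolventFn c θ ξ ω + (sliceWeightFn Λ Λ' ξ ω : ℂ) * resolventFnD1 c θ ξ ω

/-- `Ψ″ = W″R + 2W′R′ + WR″` (as a formal expression). [cite: Salmhofer1999, §4.2.5 (4.70)] -/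
def sliceSymbolFnD2 (c θ Λ Λ' ξ ω : ℝ) : ℂ :=
  (sliceWeightFnD2 Λ Λ' ξ ω : ℂ) * resolventFn c θ ξ ω + 2 * ((sliceWeightFnD1 Λ Λ' ξ ω : ℂ) * resolventFnD1 c θ ξ ω) +
    (sliceWeightFn Λ Λ' ξ ω : ℂ) * resolventFnD2 c θ ξ ω

section Symbol

variable {c θ Λ Λ' ξ : ℝ}

/-- Case split used twice: either `ω² + ξ² > Λ²/5` (and then the denominator is nonzero) or the weight vanishes identically near
`ω`. [cite: BenfattoGiulianiMastropietro2006, (2.36aa)] -/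
theorem shiftDen_ne_zero_of_gt (hθ : |θ| ≤ Λ / 4) {ω : ℝ} (h : Λ ^ 2 / 5 < ω ^ 2 + ξ ^ 2) :
    (-I * ((ω + θ : ℝ) : ℂ) + (ξ : ℂ)) ≠ 0 := by
  intro h0
  have hn := norm_sq_shiftDen θ ξ ω
  rw [h0, norm_zero] at hn
  have hθ2 : θ ^ 2 ≤ Λ ^ 2 / 16 := by
    have := sq_abs θ ▸ pow_le_pow_left₀ (abs_nonneg θ) hθ 2
    nlinarith
  nlinarith [sq_nonneg (ω + 2 * θ), sq_nonneg ξ]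

/-- **`Ψ` is differentiable everywhere with derivative `Ψ′`.** [cite: BenfattoGiulianiMastropietro2006, (2.36aa)] -/
theorem hasDerivAt_sliceSymbolFn (hΛ : 0 < Λ) (hΛΛ' : Λ ≤ Λ') (hθ : |θ| ≤ Λ / 4) (ω : ℝ) :
    HasDerivAt (sliceSymbolFn c θ Λ Λ' ξ) (sliceSymbolFnD1 c θ Λ Λ' ξ ω) ω := by
  by_cases h : Λ ^ 2 / 5 < ω ^ 2 + ξ ^ 2
  · unfold sliceSymbolFn sliceSymbolFnD1
    exact ((hasDerivAt_sliceWeightFn Λ Λ' ξ ω).ofReal_comp.mul (hasDerivAt_resolventFn (shiftDen_ne_zero_of_gt hθ h)))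
  · -- `Ψ ≡ 0` near `ω`
    have hlt : ω ^ 2 + ξ ^ 2 < Λ ^ 2 / 4 := by linarith [not_lt.1 h, pow_pos hΛ 2]
    have hopen : ∀ᶠ t in nhds ω, t ^ 2 + ξ ^ 2 < Λ ^ 2 / 4 :=
      (continuous_pow 2 |>.add continuous_const).continuousAt.eventually_lt continuousAt_const hlt
    have hev : sliceSymbolFn c θ Λ Λ' ξ =ᶠ[nhds ω] fun _ => (0 : ℂ) := by
      filter_upwards [hopen] with t ht
      rw [sliceSymbolFn, (sliceWeightFn_eq_zero_of_not_mem hΛ hΛΛ' (Or.inl ht)).1, Complex.ofReal_zero, zero_mul]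
    have hD1 : sliceSymbolFnD1 c θ Λ Λ' ξ ω = 0 := by
      obtain ⟨h0, h1, -⟩ := sliceWeightFn_eq_zero_of_not_mem hΛ hΛΛ' (ξ := ξ) (ω := ω) (Or.inl hlt)
      rw [sliceSymbolFnD1, h0, h1, Complex.ofReal_zero, zero_mul, zero_mul, add_zero]
    rw [hD1]
    exact (hasDerivAt_const ω (0 : ℂ)).congr_of_eventuallyEq hev

/-- **`Ψ′` is differentiable everywhere with derivative `Ψ″`.** [cite: BenfattoGiulianiMastropietro2006, (2.36aa)] -/
theorem hasDerivAt_sliceSymbolFnD1 (hΛ : 0 < Λ) (hΛΛ' : Λ ≤ Λ') (hθ : |θ| ≤ Λ / 4) (ω : ℝ) :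
    HasDerivAt (sliceSymbolFnD1 c θ Λ Λ' ξ) (sliceSymbolFnD2 c θ Λ Λ' ξ ω) ω := by
  by_cases h : Λ ^ 2 / 5 < ω ^ 2 + ξ ^ 2
  · have hne := shiftDen_ne_zero_of_gt hθ h
    unfold sliceSymbolFnD1 sliceSymbolFnD2
    have hA := (hasDerivAt_sliceWeightFnD1 Λ Λ' ξ ω).ofReal_comp.mul (hasDerivAt_resolventFn (c := c) hne)
    have hB := (hasDerivAt_sliceWeightFn Λ Λ' ξ ω).ofReal_comp.mul (hasDerivAt_resolventFnD1 (c := c) hne)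
    refine (hA.add hB).congr_deriv ?_
    ring
  · have hlt : ω ^ 2 + ξ ^ 2 < Λ ^ 2 / 4 := by linarith [not_lt.1 h, pow_pos hΛ 2]
    have hopen : ∀ᶠ t in nhds ω, t ^ 2 + ξ ^ 2 < Λ ^ 2 / 4 :=
      (continuous_pow 2 |>.add continuous_const).continuousAt.eventually_lt continuousAt_const hlt
    have hev : sliceSymbolFnD1 c θ Λ Λ' ξ =ᶠ[nhds ω] fun _ => (0 : ℂ) := by
      filter_upwards [hopen] with t ht
      obtain ⟨h0, h1, -⟩ := sliceWeightFn_eq_zero_of_not_mem hΛ hΛΛ' (ξ := ξ) (ω := t) (Or.inl ht)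
      rw [sliceSymbolFnD1, h0, h1, Complex.ofReal_zero, zero_mul, zero_mul, add_zero]
    have hD2 : sliceSymbolFnD2 c θ Λ Λ' ξ ω = 0 := by
      obtain ⟨h0, h1, h2⟩ := sliceWeightFn_eq_zero_of_not_mem hΛ hΛΛ' (ξ := ξ) (ω := ω) (Or.inl hlt)
      rw [sliceSymbolFnD2, h0, h1, h2, Complex.ofReal_zero]
      ring
    rw [hD2]
    exact (hasDerivAt_const ω (0 : ℂ)).congr_of_eventuallyEq hev

/-- **The second derivative of the slice symbol is at most `(32B₂ + 144B₁ + 128)·c/Λ³` everywhere** (`c ≥ 0`, `0 < Λ ≤ Λ′`,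
`|θ| ≤ Λ/4`; `B₁, B₂` bounds of `χ₂′, χ₂″`). [cite: BenfattoGiulianiMastropietro2006, (2.36aa)] -/
theorem norm_sliceSymbolFnD2_le (hΛ : 0 < Λ) (hΛΛ' : Λ ≤ Λ') (hθ : |θ| ≤ Λ / 4) (hc : 0 ≤ c) {B₁ B₂ : ℝ}
    (hB₁ : ∀ x, |deriv salmhoferCutoff x| ≤ B₁)
    (hB₂ : ∀ x, |deriv (deriv salmhoferCutoff) x| ≤ B₂) (ω : ℝ) :
    ‖sliceSymbolFnD2 c θ Λ Λ' ξ ω‖ ≤ (32 * B₂ + 144 * B₁ + 128) * c / Λ ^ 3 := by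
  have hB10 : 0 ≤ B₁ := (abs_nonneg _).trans (hB₁ 0)
  have hB20 : 0 ≤ B₂ := (abs_nonneg _).trans (hB₂ 0)
  by_cases hmem : ω ^ 2 + ξ ^ 2 < Λ ^ 2 / 4 ∨ Λ' ^ 2 < ω ^ 2 + ξ ^ 2
  · obtain ⟨h0, h1, h2⟩ := sliceWeightFn_eq_zero_of_not_mem hΛ hΛΛ' hmem
    rw [sliceSymbolFnD2, h0, h1, h2, Complex.ofReal_zero]
    simp only [zero_mul, mul_zero, add_zero, norm_zero]
    positivity
  · rw [not_or, not_lt, not_lt] at hmem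
    have hden := norm_shiftDen_ge hθ hmem.1
    set a := ‖-I * ((ω + θ : ℝ) : ℂ) + (ξ : ℂ)‖ with ha
    have ha0 : 0 < a := lt_of_lt_of_le (by positivity) hden
    have hR : ‖resolventFn c θ ξ ω‖ ≤ 4 * c / Λ := by
      rw [norm_resolventFn hc, div_le_div_iff₀ ha0 hΛ]; nlinarith
    have hR1 : ‖resolventFnD1 c θ ξ ω‖ ≤ 16 * c / Λ ^ 2 := by
      rw [norm_resolventFnD1 hc, div_le_div_iff₀ (by positivity) (by positivity)]
      have : Λ ^ 2 ≤ 16 * a ^ 2 := by nlinarith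
      nlinarith
    have hR2 : ‖resolventFnD2 c θ ξ ω‖ ≤ 128 * c / Λ ^ 3 := by
      rw [norm_resolventFnD2 hc, div_le_div_iff₀ (by positivity) (by positivity)]
      have : Λ ^ 3 ≤ 64 * a ^ 3 := by nlinarith [pow_le_pow_left₀ (by positivity : 0 ≤ Λ / 4) hden 3]
      nlinarith
    have hW : ‖(sliceWeightFn Λ Λ' ξ ω : ℂ)‖ ≤ 1 := by
      rw [Complex.norm_real, Real.norm_eq_abs]; exact abs_sliceWeightFn_le_one Λ Λ' ξ ω
    have hW1 : ‖(sliceWeightFnD1 Λ Λ' ξ ω : ℂ)‖ ≤ 4 * B₁ / Λ := by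
      rw [Complex.norm_real, Real.norm_eq_abs]; exact abs_sliceWeightFnD1_le hB₁ hΛ hΛΛ' ξ ω
    have hW2 : ‖(sliceWeightFnD2 Λ Λ' ξ ω : ℂ)‖ ≤ (8 * B₂ + 4 * B₁) / Λ ^ 2 := by
      rw [Complex.norm_real, Real.norm_eq_abs]; exact abs_sliceWeightFnD2_le hB₁ hB₂ hΛ hΛΛ' ξ ω
    rw [sliceSymbolFnD2]
    calc _ ≤ ‖(sliceWeightFnD2 Λ Λ' ξ ω : ℂ) * resolventFn c θ ξ ω‖ +
          ‖2 * ((sliceWeightFnD1 Λ Λ' ξ ω : ℂ) * resolventFnD1 c θ ξ ω)‖ +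
          ‖(sliceWeightFn Λ Λ' ξ ω : ℂ) * resolventFnD2 c θ ξ ω‖ := norm_add₃_le
      _ ≤ (8 * B₂ + 4 * B₁) / Λ ^ 2 * (4 * c / Λ) + 2 * (4 * B₁ / Λ * (16 * c / Λ ^ 2)) + 1 * (128 * c / Λ ^ 3) := by
          refine add_le_add (add_le_add ?_ ?_) ?_
          · rw [norm_mul]; exact mul_le_mul hW2 hR (norm_nonneg _) (by positivity)
          · rw [norm_mul, norm_mul, Complex.norm_ofNat]
            exact mul_le_mul_of_nonneg_left (mul_le_mul hW1 hR1 (norm_nonneg _) (by positivity)) (by norm_num)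
          · rw [norm_mul]; exact mul_le_mul hW hR2 (norm_nonneg _) zero_le_one
      _ = (32 * B₂ + 144 * B₁ + 128) * c / Λ ^ 3 := by field_simp; ring

end Symbol

/-! ### The lattice symbol is the restriction -/

/-- `(ω_n + θ)² + ξ² ≠ 0` for `0 < β`, `|βθ| ≤ π/4` (the shift never reaches a fermionic frequency).
[cite: BenfattoGiulianiMastropietro2006, §2.1 (2.3)] -/
private theorem matsubara_shift_den_ne_zero' {M : ℕ} {β : ℝ} (hβ : 0 < β) {θ : ℝ} (hθ : |β * θ| ≤ Real.pi / 4) (ξ : ℝ)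
    (i : MatsubaraIdx M) : (matsubaraFreq β M i + θ) ^ 2 + ξ ^ 2 ≠ 0 := by
  intro h
  have h0 : matsubaraFreq β M i + θ = 0 := by nlinarith [sq_nonneg (matsubaraFreq β M i + θ), sq_nonneg ξ]
  have hω := pi_div_le_abs_matsubaraFreq hβ i
  have h2 : β * |matsubaraFreq β M i| ≥ Real.pi := by
    have := mul_le_mul_of_nonneg_left hω hβ.le
    rwa [mul_div_cancel₀ _ hβ.ne'] at this
  have h1 : |β * θ| = β * |θ| := by rw [abs_mul, abs_of_pos hβ]
  have h3 : |θ| = |matsubaraFreq β M i| := by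
    rw [show θ = -matsubaraFreq β M i by linarith, abs_neg]
  nlinarith [Real.pi_pos, abs_nonneg θ]

/-- **The shifted slice symbol at a Matsubara frequency is the continuum function**: for `0 < β`, `|βθ| ≤ π/4`,
`(w_Λ(k) - w_{Λ′}(k))·p_θ(k, σ) = Ψ_{ξ(k⃗)}(ω_i)` with `c = βL²`. [cite: Salmhofer1999, §4.2.5 (4.70)] -/
theorem sliceSymbol_eq_sliceSymbolFn {L M : ℕ} [NeZero L] {β : ℝ} (hβ : 0 < β) (μ : ℝ) {θ : ℝ}
    (hθ : |β * θ| ≤ Real.pi / 4) (Λ Λ' : ℝ) (i : MatsubaraIdx M) (kv : TorusSite 2 L) (σ : Fin 2) :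
    ((hubbardCutoffWeight L M β μ Λ (i, kv) : ℂ) - (hubbardCutoffWeight L M β μ Λ' (i, kv) : ℂ)) *
        shiftedFreeSymbol L M β μ θ ((i, kv), σ) =
      sliceSymbolFn (β * (L : ℝ) ^ 2) θ Λ Λ' (nambuXi L μ kv) (matsubaraFreq β M i) := by
  rw [sliceSymbolFn, sliceWeightFn, resolventFn, shiftedFreeSymbol_eq_div β μ θ ((i, kv), σ)
    (matsubara_shift_den_ne_zero' hβ hθ _ i), hubbardCutoffWeight, hubbardCutoffWeight]
  push_cast
  ring

end Literature.MathematicalPhysics.QuantumLattice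

end
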